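import Summits.Ventures.Crystal3D.Theorems.StickyWulffConstantNoReconstructionGainCertificate
import Summits.Ventures.Crystal3D.Theorems.StickyWulffConstantNoReconstructionGainConeBand
import HarnessLib

/-!
# Layered-film adhesion from a joint level/support bound (line `joint-level-support-bound`)

HONEST FRAMING. Part of the venture `Summits/Ventures/Crystal3D` (cell `crystal3d-full`), supports the
crux `NoReconstructionGain` (stmt-Ventures-19144, route `route-Ventures-StickyWulffConstant`), line
`joint-level-support-bound` (skeleton `Cruxes/NoReconstructionGain/Lines/joint_level_support_bound.lean`,
registered 2026-08-28).  THE REGISTERED BOOKKEEPING STUB `stub_layeredAdhesion_of_jointBound`, by name: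
if a joint bound `JB(t, β)` — `2·#{u : ⟪u,ν⟫ ≤ -t} + #{u : |⟪u,ν⟫| ≤ β} ≤ 12` for every
kissing-separated set `U` of unit vectors — holds, and the film `X \ P` carries an integer layer index
`L` such that, seen from every non-exempt film ball `q`, substrate partners and lower-layer partners are
`t`-deep and same-layer partners are `β`-level, then `#cross(P, X \ P) ≤ contactDeficiency (X \ P) + 6·#E`.

Proof: the landed potential certificate `cross_le_of_potential` with `Φ := L`; at `q` the partner
directions `y - q` form a kissing-separated set of unit vectors (`inner_le_half_of_one_le_dist`), the
substrate and lower-layer partners inject into its deep part and the same-layer partners into its level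
part, so `JB` is exactly the per-ball inequality (T2) in the symmetric form `noGainPotential_iff`.

WHAT THIS IS NOT: the joint bound itself (stubs `stub_jointBound_deepHeavy` / `stub_jointBound_levelHeavy`
of the line), nor the crux (residual `stub_adhesion_nonLayeredCore`); rung F-C1 not moved.
-/

noncomputable section

namespace Summit.Ventures.Crystal3D.Theorems

open Summit.Ventures.Crystal3D Finset
open Literature.MathematicalPhysics.StatisticalMechanics (contactDeficiency)
open scoped InnerProductSpace

/-- **Registered stub `stub_layeredAdhesion_of_jointBound` (line `joint-level-support-bound`).**  A
joint level/support bound `JB(t, β)` for kissing-separated direction sets, together with an integer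
layer index `L` on the film making every non-exempt film ball's substrate and lower-layer partners
`t`-deep and its same-layer partners `β`-level (directions against `ν`), gives the adhesion inequality
`#cross(P, X \ P) ≤ contactDeficiency (X \ P) + 6·#E`.  It is `cross_le_of_potential` with `Φ := L`. -/
theorem stub_layeredAdhesion_of_jointBound :
    ∀ t β : ℝ,
      (∀ ν : EuclideanSpace ℝ (Fin 3), ‖ν‖ = 1 → ∀ U : Finset (EuclideanSpace ℝ (Fin 3)),
        (∀ u ∈ U, ‖u‖ = 1) → (∀ u ∈ U, ∀ w ∈ U, u ≠ w → ⟪u, w⟫_ℝ ≤ 1 / 2) →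
        2 * (U.filter fun u => ⟪u, ν⟫_ℝ ≤ -t).card
          + (U.filter fun u => |⟪u, ν⟫_ℝ| ≤ β).card ≤ 12) →
      ∀ ν : EuclideanSpace ℝ (Fin 3), ‖ν‖ = 1 →
      ∀ X P E : Finset (EuclideanSpace ℝ (Fin 3)),
      (∀ p ∈ X, ∀ q ∈ X, p ≠ q → 1 ≤ dist p q) → P ⊆ X → E ⊆ X \ P →
      ∀ L : EuclideanSpace ℝ (Fin 3) → ℤ,
      (∀ q ∈ (X \ P) \ E, ∀ y ∈ X, dist q y = 1 →
        (y ∈ P → ⟪y - q, ν⟫_ℝ ≤ -t) ∧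
        (y ∉ P → (L y = L q → |⟪y - q, ν⟫_ℝ| ≤ β) ∧ (L y < L q → ⟪y - q, ν⟫_ℝ ≤ -t))) →
      ((((P ×ˢ (X \ P)).filter fun pq => dist pq.1 pq.2 = 1).card : ℕ) : ℝ) ≤
        contactDeficiency (X \ P) + 6 * (E.card : ℝ) := by
  classical
  intro t β hJB ν hν X P E hX hPX hE L hL
  refine cross_le_of_potential X P E hX hPX hE L fun q hq => ?_
  rw [noGainPotential_iff X P hPX L q]
  have hLq := hL q hq
  -- the partner directions of `q`
  set N := X.filter fun y => dist q y = 1 with hN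
  set U := N.image fun y => y - q with hU
  have hinj : Set.InjOn (fun y : EuclideanSpace ℝ (Fin 3) => y - q) ↑N :=
    fun a _ b _ h => sub_left_injective h
  have hUnorm : ∀ u ∈ U, ‖u‖ = 1 := by
    intro u hu
    obtain ⟨y, hy, rfl⟩ := mem_image.1 hu
    rw [← dist_eq_norm, dist_comm]
    exact (mem_filter.1 hy).2
  have hUsep : ∀ u ∈ U, ∀ w ∈ U, u ≠ w → ⟪u, w⟫_ℝ ≤ 1 / 2 := by
    intro u hu w hw huw
    have hu1 := hUnorm u hu
    have hw1 := hUnorm w hw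
    obtain ⟨y, hy, rfl⟩ := mem_image.1 hu
    obtain ⟨y', hy', rfl⟩ := mem_image.1 hw
    have hne : y ≠ y' := fun h => huw (by rw [h])
    refine inner_le_half_of_one_le_dist hu1 hw1 ?_
    rw [dist_eq_norm, sub_sub_sub_cancel_right, ← dist_eq_norm]
    exact hX y (mem_filter.1 hy).1 y' (mem_filter.1 hy').1 hne
  have hJ := hJB ν hν U hUnorm hUsep
  -- substrate and lower-layer partners inject into the deep directions
  have hsub1 : ((P.filter fun p => dist q p = 1) ∪
      ((X \ P).filter fun x => dist q x = 1 ∧ L x < L q)).image (fun y => y - q) ⊆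
      U.filter fun u => ⟪u, ν⟫_ℝ ≤ -t := by
    intro u hu
    obtain ⟨y, hy, rfl⟩ := mem_image.1 hu
    rw [mem_filter]
    rcases mem_union.1 hy with hyP | hyQ
    · have hyP' := mem_filter.1 hyP
      refine ⟨mem_image.2 ⟨y, mem_filter.2 ⟨hPX hyP'.1, hyP'.2⟩, rfl⟩, ?_⟩
      exact (hLq y (hPX hyP'.1) hyP'.2).1 hyP'.1
    · have hyQ' := mem_filter.1 hyQ
      have hyX : y ∈ X := (mem_sdiff.1 hyQ'.1).1
      have hynP : y ∉ P := (mem_sdiff.1 hyQ'.1).2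
      refine ⟨mem_image.2 ⟨y, mem_filter.2 ⟨hyX, hyQ'.2.1⟩, rfl⟩, ?_⟩
      exact ((hLq y hyX hyQ'.2.1).2 hynP).2 hyQ'.2.2
  have hdisj : Disjoint (P.filter fun p => dist q p = 1)
      ((X \ P).filter fun x => dist q x = 1 ∧ L x < L q) := by
    refine disjoint_left.2 fun y hyP hyQ => ?_
    exact (mem_sdiff.1 (mem_filter.1 hyQ).1).2 (mem_filter.1 hyP).1
  have hinj' : Set.InjOn (fun y : EuclideanSpace ℝ (Fin 3) => y - q)
      ↑((P.filter fun p => dist q p = 1) ∪ ((X \ P).filter fun x => dist q x = 1 ∧ L x < L q)) :=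
    fun a _ b _ h => sub_left_injective h
  have h1 : (P.filter fun p => dist q p = 1).card +
      ((X \ P).filter fun x => dist q x = 1 ∧ L x < L q).card ≤
      (U.filter fun u => ⟪u, ν⟫_ℝ ≤ -t).card := by
    rw [← card_union_of_disjoint hdisj, ← card_image_of_injOn hinj']
    exact card_le_card hsub1
  -- same-layer partners inject into the level directions
  have hsub2 : ((X \ P).filter fun x => dist q x = 1 ∧ L x = L q).image (fun y => y - q) ⊆
      U.filter fun u => |⟪u, ν⟫_ℝ| ≤ β := by
    intro u hu
    obtain ⟨y, hy, rfl⟩ := mem_image.1 hu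
    have hy' := mem_filter.1 hy
    have hyX : y ∈ X := (mem_sdiff.1 hy'.1).1
    have hynP : y ∉ P := (mem_sdiff.1 hy'.1).2
    rw [mem_filter]
    refine ⟨mem_image.2 ⟨y, mem_filter.2 ⟨hyX, hy'.2.1⟩, rfl⟩, ?_⟩
    exact ((hLq y hyX hy'.2.1).2 hynP).1 hy'.2.2
  have hinj'' : Set.InjOn (fun y : EuclideanSpace ℝ (Fin 3) => y - q)
      ↑((X \ P).filter fun x => dist q x = 1 ∧ L x = L q) :=
    fun a _ b _ h => sub_left_injective h
  have h2 : ((X \ P).filter fun x => dist q x = 1 ∧ L x = L q).card ≤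
      (U.filter fun u => |⟪u, ν⟫_ℝ| ≤ β).card := by
    rw [← card_image_of_injOn hinj'']
    exact card_le_card hsub2
  omega

end Summit.Ventures.Crystal3D.Theorems

end
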